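import Summits.BirchSwinnertonDyer.BirchSwinnertonDyer.Theorems.MordellShaFreeCutThreeAdicExistenceFromPrint
import Summits.BirchSwinnertonDyer.BirchSwinnertonDyer.Theorems.MordellShaFreeCutKatoBDPReciprocity
import Summits.BirchSwinnertonDyer.BirchSwinnertonDyer.Theorems.CongruentShaFreeCutKatoReading31b
import Summits.BirchSwinnertonDyer.BirchSwinnertonDyer.Theorems.CongruentShaFreeCutKatoZetaRoadReadings
import Literature.NumberTheory.EllipticCurves.Kato2004.IwasawaCohomologyExistsProofs
import Literature.NumberTheory.EllipticCurves.Kato2004.LocPKernelRankOneProofs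
import HarnessLib

set_option linter.dupNamespace false
set_option autoImplicit false

/-! # Route `MordellShaFreeCut` (rung S2b) — THE JOINED ROAD WITH THE EXISTENCE HALF FROM PRINT: crux B ⟸ {nine kato-zeta facts,
(T1), Tate–Sen, BDP13} [ALL citation-borne] + (LB-bdp) value formula at 𝟙 [WRITTEN] + (ERL₃) Kato ↔ BDP reciprocity [OPEN]

Cell `bsd-cn100`, prover seat `bsd-cn100-s2b-c3` (g8). Supports, does not close, stmt-BirchSwinnertonDyer-19160 (crux B
`AnalyticRankOneOfRankOneFiniteShaThree`). THEOREMS ONLY (0 def, 0 new fact). Combines this seat's three results of the day: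
(i) `MordellShaFreeCutRoadsMeetCensus` (p488624): crux B ⟸ nine named facts + EV∃ + (ERL₃) — (LB-wan) not needed;
(ii) `MordellShaFreeCutThreeAdicExistenceFromPrint` (p489731): the EXISTENCE half of EV∃ at Heegner fields of ODD discriminant
is citation-borne ((T1) + Tate–Sen + BDP13 Thm 5.5), and the crux-B plumbing may choose `d_K ≡ 1 (mod 8)`;
(iii) `MordellShaFreeCutKatoBDPReciprocity` (p488113): `PRFormulaAtThreeH2 ⟸ EV∃ ∧ (ERL₃)`.
Restricting (iii) and the kato-zeta plumbing `heegnerNonTorsion_of_prFormulaH2_of_readings` (p467387) to odd `d_K`: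
* §0 `forall_pow_smul_iota_zeta_ne_zero'` — Burungale–Tian's `Λ`-module step (re-proved; the PinnedH2 copy is private).
* §1 `prFormulaAtThreeOddDisc_of_existsOddDisc_of_value_of_reciprocity` — PR at odd `d_K` ⟸ existence-odd + (LB-bdp) + (ERL₃).
* §2 `heegnerNonTorsionOddDisc_of_prFormulaOddDisc_of_readings` — [ABS] §10.1.3 at odd `d_K` (p467387's proof, one binder more).
* §3 **`cruxB_of_namedFacts_of_anyLevel_of_tateSen_of_bdp2013_of_value_of_reciprocity`** — THE END-STATE CENSUS: crux B ⟸
  {six refereed theorems, `nonempty_iwasawaH2Data`, `thm12_4`, `finite_descentCokernel_of_rankOne`, (T1)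
  `Hsieh2014.thmA_exists_isHsiehLFunction_unrPeriod_anyLevel`, `TateSenCharacterVanishing 3`,
  `bertoliniDarmonPrasanna2013_centralValue_reciprocity`} [TWELVE citation-borne named facts; conj `nonempty_iwasawaH1Data` /
  `locP_kernel_isTorsion_of_rankOne` are the tree theorems `…_holds`] + `ThreeAdicBDPValueAtOne` [(LB-bdp), WRITTEN: MEMO-13
  Thm 13.2 twin] + `ThreeAdicKatoBDPReciprocity` [(ERL₃), OPEN research]. On this census the research content of S2b's crux B
  is ONE value formula at 𝟙 and ONE explicit reciprocity law at the additive prime `3`; no anticyclotomic CONSTRUCTION, no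
  Wan-type divisibility, no descent statement remains.
HONEST FRAMING: CONDITIONAL compositions over named facts; nothing here proves (LB-bdp), (ERL₃), crux A/B, the leaf, Sylvester's
conjecture or any case of BSD; T exactly as open as before. PARTITION: none — RANK axis.
[cite: AlpogeBhargavaShnidman2022, App. A Thm. 10.1, Thm. 10.8, §10.1.3 (pp. 33–34)] [cite: BurungaleTian2026, Thm. 2.6 and Thm. 3.1]
[cite: Kato2004Asterisque, Thm. 12.4, Conj. 12.10, (14.9.3), §14.14, Cor. 14.3] [cite: BertoliniDarmonPrasanna2013, Thm. 5.5]
[cite: Hsieh2014, Thm. A] [cite: BrinonConrad2009, Thm. 2.2.7] -/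

noncomputable section

open scoped NumberField Classical

open PowerSeries WeierstrassCurve NumberField IsDedekindDomain Field Literature.NumberTheory.EllipticCurves
  Literature.NumberTheory.EllipticCurves.ModularForms Literature.NumberTheory.QuadraticFields
  Literature.NumberTheory.EllipticCurves.Castella2018 Literature.NumberTheory.EllipticCurves.Kato2004
  Literature.NumberTheory.EllipticCurves.Rank1Residual
open Literature.NumberTheory.GaloisRepresentations Literature.NumberTheory.GaloisCohomology
open Literature.NumberTheory.PAdicHodge (TateSenCharacterVanishing)
open Summit.BirchSwinnertonDyer.Rank1Residual.Additive (KatoDescentDatum)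
open Summit.BirchSwinnertonDyer.BirchSwinnertonDyer.Theses.MordellShaFreeCut (AnalyticRankOneOfRankOneFiniteShaThree)
open Summit.BirchSwinnertonDyer.BirchSwinnertonDyer.Theorems.CongruentShaFreeCutKatoDescentDatumOfH2
open Summit.BirchSwinnertonDyer.BirchSwinnertonDyer.Theorems.MordellShaFreeCutThreeAdicBDPTriple (ThreeAdicBDPValueAtOne)
open Summit.BirchSwinnertonDyer.BirchSwinnertonDyer.Theorems.MordellShaFreeCutKatoBDPReciprocity (ThreeAdicKatoBDPReciprocity)
open Summit.BirchSwinnertonDyer.BirchSwinnertonDyer.Theorems.MordellShaFreeCutThreeAdicExistenceFromPrint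
  (threeAdicBDPElementExistsOddDisc_of_anyLevel_of_tateSen_of_bdp2013 analyticRankOne_of_facts_of_heegnerNonTorsionOddDisc)

namespace Summit.BirchSwinnertonDyer.BirchSwinnertonDyer.Theorems.MordellShaFreeCutRoadsMeetFromPrint

/-! ## §0 Burungale–Tian's `Λ`-module step (re-proved; the PinnedH2 copy is private) -/

/-- **Burungale–Tian's `Λ`-module step on a Kato descent datum**: if Kato's Main Conjecture 12.10 holds for `D` up to powers
of `p` and `H2/TH2` is finite, then `ι(z mod TH)` is not `ℤ_p`-torsion (the Literature generator lemma
`IwasawaAlgebra.exists_forall_pow_smul_mkQ_ne_zero_of_span_pow_mul_charIdeal_eq` with `G = {z}`, and the injectivity of `ι`);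
same statement and proof as the private `MordellShaFreeCutKatoZetaRoadPinnedH2.forall_pow_smul_iota_zeta_ne_zero`.
[cite: BurungaleTian2026, Thm. 3.1 (proof, p. 6: (3.1)–(3.2)) and Remark 3.2] [cite: Kato2004Asterisque, Conj. 12.10 (p. 224) and §14.14 (14.14.1) (p. 243)] -/
theorem forall_pow_smul_iota_zeta_ne_zero' {p : ℕ} [Fact p.Prime] (D : KatoDescentDatum p)
    (hMC : ∃ a b : ℕ,
      Ideal.span {(p : IwasawaAlgebra p) ^ a} * Module.charIdeal (IwasawaAlgebra p) D.H2 =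
        Ideal.span {(p : IwasawaAlgebra p) ^ b} *
          Module.charIdeal (IwasawaAlgebra p) (D.H ⧸ (IwasawaAlgebra p) ∙ D.z))
    (hfin : Finite (IwasawaAlgebra.coinvariants p D.H2)) :
    ∀ m : ℕ, p ^ m • D.ι (Submodule.Quotient.mk D.z) ≠ 0 := by
  have hG : ∃ g ∈ ({D.z} : Set D.H), g ≠ 0 := ⟨D.z, Set.mem_singleton _, D.z_ne_zero⟩
  obtain ⟨g, hg, h⟩ :=
    IwasawaAlgebra.exists_forall_pow_smul_mkQ_ne_zero_of_span_pow_mul_charIdeal_eq p hG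
      D.isTorsion_quotient D.isTorsion_H2 hMC hfin
  rw [Set.mem_singleton_iff] at hg
  subst hg
  intro m hm
  refine h m (D.ι_injective ?_)
  rw [map_nsmul, hm, map_zero]

/-! ## §1 Perrin-Riou's formula at ODD `d_K` from existence-odd + (LB-bdp) + (ERL₃) -/

/-- **Perrin-Riou's formula at `3` RESTRICTED TO HEEGNER FIELDS OF ODD DISCRIMINANT ⟸ (LB-exist) at odd `d_K` (`hE`, from
print: `MordellShaFreeCutThreeAdicExistenceFromPrint`) + the ∀-frame value formula (LB-bdp) (`hV`) + (ERL₃) (`hERL`).** The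
conclusion is `PRFormulaAtThreeH2` with the binder `Odd d_K` inserted; the proof is p488113's
`prFormulaAtThreeH2_of_bdpExistsValue_of_reciprocity` with EV∃'s single `obtain` split into existence + value. CONDITIONAL;
credits nothing beyond the reduction. [cite: AlpogeBhargavaShnidman2022, App. A Thm. 10.8 (a) (p. 33) and §10.1.2–§10.1.3]
[cite: CastellaGrossiLeeSkinner2022, §2 (the place induced by ι_p)] -/
theorem prFormulaAtThreeOddDisc_of_existsOddDisc_of_value_of_reciprocity
    (hE : ∀ (W : WeierstrassCurve ℚ) [W.IsElliptic] [W.IsGloballyMinimal], W.j = 0 →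
      ∀ (K : Type) [Field K] [NumberField K] (N : ℕ) [NeZero N]
        (Dt : ModularParametrizationData W N)
        (v : HeightOneSpectrum (𝓞 K)) (κ : ZpExtension K 3) (γ : absoluteGaloisGroup K)
        [Fact (κ.IsTopGenerator γ)],
      W.conductorNorm ℤ = N → IsImaginaryQuadratic K → Odd (NumberField.discr K) →
      SatisfiesHeegnerHypothesis N K → ((Ideal.span {(3 : ℤ)}).primesOver (𝓞 K)).ncard = 2 →
      ((3 : ℕ) : 𝓞 K) ∈ v.asIdeal → κ.IsAnticyclotomic →
      ∃ ι' : PadicAlgCl 3 ≃+* ℂ,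
        (∀ (w : InfinitePlace K) (k : 𝓞 K), k ∈ v.asIdeal ↔ ‖ι'.symm (w.embedding (k : K))‖ < 1) ∧
        ∃ (ΩK : ℂ) (Ωp : (unrIntegers 3)ˣ) (L : UnrSeries 3),
          ΩK ≠ 0 ∧ IsBDPLFunction ι' v κ γ Dt.f ΩK ((Ωp : unrIntegers 3) : ℂ_[3]) L)
    (hV : ThreeAdicBDPValueAtOne) (hERL : ThreeAdicKatoBDPReciprocity) :
    ∀ (W : WeierstrassCurve ℚ) [W.IsElliptic] [W.IsGloballyMinimal]
      [ContinuousSMul ℤ_[3] (W.tateModule 3)], W.j = 0 →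
      ∀ (K : Type) [Field K] [NumberField K] (N : ℕ) [NeZero N],
        W.conductorNorm ℤ = N → IsImaginaryQuadratic K → Odd (NumberField.discr K) →
          SatisfiesHeegnerHypothesis N K → SatisfiesHeegnerHypothesis 3 K →
            (W.quadraticTwist (NumberField.discr K : ℚ)).entireLFunction 1 ≠ 0 →
        ∀ (ι : K →+* ℚ_[3]) (P : (W.baseChange K).toAffine.Point), IsHeegnerPoint N W K P →
          W.entireLFunction 1 = 0 →
        ∀ (D : KatoDescentDatum 3) (pin : KatoDescentDatumPinH2 W 3 D),
          (∃ a b : ℕ,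
            Ideal.span {((3 : ℕ) : IwasawaAlgebra 3) ^ a} * Module.charIdeal (IwasawaAlgebra 3) D.H2 =
              Ideal.span {((3 : ℕ) : IwasawaAlgebra 3) ^ b} *
                Module.charIdeal (IwasawaAlgebra 3) (D.H ⧸ (IwasawaAlgebra 3) ∙ D.z)) →
          ∃ c : ℚ_[3], c ≠ 0 ∧
            HasLocPKummerLog W 3 pin.katoClass (c * padicLogOmega W 3 ι P ^ 2) := by
  intro W _ _ _ hj K _ _ N _ hN hK hodd hHN hH3 hLtw ι P hP hL1 D pin hMC
  haveI : Fact (Nat.Prime 3) := ⟨Nat.prime_three⟩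
  -- (0) `3 = v v̄` splits in `K`
  have hsplit : ((Ideal.span {(3 : ℤ)}).primesOver (𝓞 K)).ncard = 2 := by
    simpa using hH3 3 Nat.prime_three (dvd_refl 3)
  -- (1) the Heegner reading of `P`, conjugated to THE infinite place `w₀`
  obtain ⟨Dt, H, ιK, hPι⟩ := hP
  obtain ⟨w₀⟩ := (inferInstance : Nonempty (InfinitePlace K))
  haveI : IsGalois ℚ K := by
    haveI : Algebra.IsQuadraticExtension ℚ K := ⟨hK.1⟩
    infer_instance
  obtain ⟨σ, hσ⟩ := ComplexEmbedding.exists_comp_symm_eq_of_comp_eq (k := ℚ) w₀.embedding ιK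
    (by ext x; simp)
  set τ : K →+* K := ((σ.symm : K ≃ₐ[ℚ] K) : K →+* K) with hτdef
  set P' := WeierstrassCurve.Affine.Point.map τ.toRatAlgHom P with hP'def
  have hP' : WeierstrassCurve.Affine.Point.map w₀.embedding.toRatAlgHom P' =
      heegnerPointComplex Dt H := by
    rw [hP'def, WeierstrassCurve.Affine.Point.map_map]
    have hcomp : w₀.embedding.toRatAlgHom.comp τ.toRatAlgHom = ιK.toRatAlgHom := by
      apply AlgHom.ext
      intro x
      have := RingHom.congr_fun hσ x
      simpa [hτdef] using this
    rw [hcomp]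
    exact hPι
  -- (2) the embedding `e = ι ∘ τ⁻¹`, its induced place `v ∋ 3`, an anticyclotomic `(κ, γ)`
  set e : K →+* ℚ_[3] := ι.comp (σ : K →+* K) with hedef
  have hlog : padicLogOmega W 3 e P' = padicLogOmega W 3 ι P := MordellShaFreeCutKatoBDPReciprocity.padicLogOmega_comp_map_symm W ι σ P
  set v := Summit.BirchSwinnertonDyer.Rank1Residual.X11b.inducedPlace e with hvdef
  have hv : ∀ x : 𝓞 K, x ∈ v.asIdeal ↔ ‖e (x : K)‖ < 1 :=
    Summit.BirchSwinnertonDyer.Rank1Residual.X11b.mem_inducedPlace_iff e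
  have hv3 : ((3 : ℕ) : 𝓞 K) ∈ v.asIdeal :=
    Summit.BirchSwinnertonDyer.Rank1Residual.X11b.natCast_mem_inducedPlace e
  obtain ⟨κ, γ, -, hκ, hγ, -, -, -⟩ :=
    Summit.BirchSwinnertonDyer.Rank1Residual.X11b.exists_anticyclotomic_generator_degreeOnePrime
      3 K hK hH3
  haveI : Fact (κ.IsTopGenerator γ) := ⟨hγ⟩
  -- (3) existence at the ODD-discriminant datum (from print) + the ∀-frame value formula at the reading
  obtain ⟨ι', hι', ΩK, Ωp, L, hΩK, hBDP⟩ := hE W hj K N Dt v κ γ hN hK hodd hHN hsplit hv3 hκ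
  obtain ⟨u, hu⟩ := hV W hj ι' K N Dt H w₀ e v κ γ P' hN hK hHN hsplit hv3 hι' hκ hP' hv ΩK Ωp L hΩK hBDP
  have hu0 : (((u : (unrIntegers 3)ˣ) : unrIntegers 3) : ℂ_[3]) ≠ 0 := by
    intro h0
    have h1 := (unrIntegers.isUnit_iff_norm_eq_one _).1 u.isUnit
    rw [h0, norm_zero] at h1
    exact zero_ne_one h1
  -- (4) (ERL₃) at the same frame and the given pinned datum
  obtain ⟨t, c, hc0, hKum, ht⟩ :=
    hERL W hj K N Dt v κ γ hN hK hHN hH3 hLtw hsplit hv3 hκ hL1 ι' hι' ΩK Ωp L hΩK hBDP D pin hMC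
  -- (5) compare the two values at `𝟙`
  have heq := ht.unique hu
  rw [hlog] at heq
  set A : ℚ_[3] := ((Dt.c : ℚ_[3])⁻¹) ^ 2 *
      (1 - (W.LFunction 3 : ℚ_[3]) * (3 : ℚ_[3])⁻¹ + (if (3 : ℕ) ∣ N then 0 else (3 : ℚ_[3])⁻¹)) ^ 2
    with hAdef
  have hA0 : A ≠ 0 := MordellShaFreeCutKatoBDPReciprocity.valueConstant_ne_zero W hj Dt hN
  -- (6) the constant `c_P`
  by_cases hlog0 : padicLogOmega W 3 ι P = 0
  · -- torsion-type case: `𝓛(𝟙) = 0`, so `t = 0`; any constant serves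
    refine ⟨1, one_ne_zero, ?_⟩
    have ht0 : t = 0 := by
      have h1 : (c : ℂ_[3]) * algebraMap ℚ_[3] ℂ_[3] t = 0 := by
        rw [heq, hlog0]; simp
      rcases mul_eq_zero.mp h1 with h | h
      · exact absurd h hc0
      · exact (map_eq_zero_iff _ (algebraMap ℚ_[3] ℂ_[3]).injective).mp h
    rw [hlog0]
    simpa [ht0] using hKum
  · refine ⟨t / padicLogOmega W 3 ι P ^ 2, ?_, ?_⟩
    · -- `c_P ≠ 0`: `t ≠ 0` since `c · t = u · A · log² ≠ 0`
      have ht0 : t ≠ 0 := by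
        intro h0
        rw [h0, map_zero, mul_zero] at heq
        have h1 : (((u : (unrIntegers 3)ˣ) : unrIntegers 3) : ℂ_[3]) *
            algebraMap ℚ_[3] ℂ_[3] (A * padicLogOmega W 3 ι P ^ 2) = 0 := by
          rw [hAdef]; exact heq.symm
        rcases mul_eq_zero.mp h1 with h | h
        · exact hu0 h
        · rw [map_eq_zero_iff _ (algebraMap ℚ_[3] ℂ_[3]).injective] at h
          exact (mul_ne_zero hA0 (pow_ne_zero 2 hlog0)) h
      exact div_ne_zero ht0 (pow_ne_zero 2 hlog0)
    · rw [div_mul_cancel₀ t (pow_ne_zero 2 hlog0)]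
      exact hKum

/-! ## §2 [ABS] §10.1.3 at ODD `d_K`: Heegner points are non-torsion -/

/-- **Heegner points of a `j = 0` curve are non-torsion at a rank-one `Ш[3^∞]`-finite datum over a Heegner field of ODD
discriminant, on the pinned Kato–zeta road** — p467387's `heegnerNonTorsion_of_prFormulaH2_of_readings` with the binder
`Odd d_K` threaded to Perrin-Riou's formula (`hPR`, now needed at odd `d_K` only). Displayed hypotheses: Kato's finiteness
theorem, (R+K) `hRK`, (3.1′) `h31` (free schema), (3.1″) `h31b`, (PR₃)-odd `hPR`. Proof = [ABS] §10.1.3 verbatim.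
CONDITIONAL; closes nothing. [cite: AlpogeBhargavaShnidman2022, App. A §10.1.3 (pp. 33–34)] [cite: BurungaleTian2026, Thm. 2.6 and Thm. 3.1]
[cite: Kato2004Asterisque, Cor. 14.3] -/
theorem heegnerNonTorsionOddDisc_of_prFormulaOddDisc_of_readings
    (hKato : ∀ (W : WeierstrassCurve ℚ) [W.IsElliptic] (p : ℕ) [Fact p.Prime],
      kato_finite_of_L_one_ne_zero W p)
    (hRK : ∀ (W : WeierstrassCurve ℚ) [W.IsElliptic] [W.IsGloballyMinimal]
      [ContinuousSMul ℤ_[3] (W.tateModule 3)], W.j = 0 →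
        ∃ D : KatoDescentDatum 3, Nonempty (KatoDescentDatumPinH2 W 3 D) ∧
          ∃ a b : ℕ,
            Ideal.span {((3 : ℕ) : IwasawaAlgebra 3) ^ a} * Module.charIdeal (IwasawaAlgebra 3) D.H2 =
              Ideal.span {((3 : ℕ) : IwasawaAlgebra 3) ^ b} *
                Module.charIdeal (IwasawaAlgebra 3) (D.H ⧸ (IwasawaAlgebra 3) ∙ D.z))
    (h31 : ∀ (W : WeierstrassCurve ℚ) [W.IsElliptic] [W.IsGloballyMinimal]
      [ContinuousSMul ℤ_[3] (W.tateModule 3)] (D : KatoDescentDatum 3), W.j = 0 →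
        Nonempty (KatoDescentDatumPinH2 W 3 D) → W.mordellWeilRank = 1 →
          Finite (AddCommGroup.primaryComponent W.sha 3) →
            Finite (IwasawaAlgebra.coinvariants 3 D.H2))
    (h31b : ∀ (W : WeierstrassCurve ℚ) [W.IsElliptic] [W.IsGloballyMinimal]
      [ContinuousSMul ℤ_[3] (W.tateModule 3)] (D : KatoDescentDatum 3)
      (pin : KatoDescentDatumPinH2 W 3 D), W.j = 0 → W.mordellWeilRank = 1 →
        Finite (AddCommGroup.primaryComponent W.sha 3) →
          (∀ m : ℕ, 3 ^ m • D.ι (Submodule.Quotient.mk D.z) ≠ 0) →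
            ∀ t : ℚ_[3], HasLocPKummerLog W 3 pin.katoClass t → t ≠ 0)
    (hPR : ∀ (W : WeierstrassCurve ℚ) [W.IsElliptic] [W.IsGloballyMinimal]
      [ContinuousSMul ℤ_[3] (W.tateModule 3)], W.j = 0 →
      ∀ (K : Type) [Field K] [NumberField K] (N : ℕ) [NeZero N],
        W.conductorNorm ℤ = N → IsImaginaryQuadratic K → Odd (NumberField.discr K) →
          SatisfiesHeegnerHypothesis N K → SatisfiesHeegnerHypothesis 3 K →
            (W.quadraticTwist (NumberField.discr K : ℚ)).entireLFunction 1 ≠ 0 →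
        ∀ (ι : K →+* ℚ_[3]) (P : (W.baseChange K).toAffine.Point), IsHeegnerPoint N W K P →
          W.entireLFunction 1 = 0 →
        ∀ (D : KatoDescentDatum 3) (pin : KatoDescentDatumPinH2 W 3 D),
          (∃ a b : ℕ,
            Ideal.span {((3 : ℕ) : IwasawaAlgebra 3) ^ a} * Module.charIdeal (IwasawaAlgebra 3) D.H2 =
              Ideal.span {((3 : ℕ) : IwasawaAlgebra 3) ^ b} *
                Module.charIdeal (IwasawaAlgebra 3) (D.H ⧸ (IwasawaAlgebra 3) ∙ D.z)) →
          ∃ c : ℚ_[3], c ≠ 0 ∧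
            HasLocPKummerLog W 3 pin.katoClass (c * padicLogOmega W 3 ι P ^ 2)) :
    ∀ (W : WeierstrassCurve ℚ) [W.IsElliptic] [W.IsGloballyMinimal], W.j = 0 →
      ∀ (K : Type) [Field K] [NumberField K] (N : ℕ) [NeZero N], W.conductorNorm ℤ = N →
        IsImaginaryQuadratic K → Odd (NumberField.discr K) →
          SatisfiesHeegnerHypothesis N K → SatisfiesHeegnerHypothesis 3 K →
          (W.quadraticTwist (NumberField.discr K : ℚ)).entireLFunction 1 ≠ 0 →
            W.mordellWeilRank = 1 → Finite (AddCommGroup.primaryComponent W.sha 3) →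
              ∀ (P : (W.baseChange K).toAffine.Point), IsHeegnerPoint N W K P →
                ¬ IsOfFinAddOrder P := by
  intro W _ _ hj K _ _ N _ hN hK hodd hHN hH3 hLK hrank hsha P hP hPtor
  haveI : Fact (Nat.Prime 3) := ⟨Nat.prime_three⟩
  haveI : ContinuousSMul ℤ_[3] (W.tateModule 3) := TateModule.continuousSMul_padicInt
  -- an embedding `ι : K → ℚ₃` at a degree-one prime over `3` (`3` splits in `K`)
  obtain ⟨-, -, 𝔭, -, -, h𝔭, he, hf⟩ :=
    Summit.BirchSwinnertonDyer.Rank1Residual.X11b.exists_anticyclotomic_generator_degreeOnePrime 3 K hK hH3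
  set ι : K →+* ℚ_[3] := Summit.BirchSwinnertonDyer.Rank1Residual.X11b.embAt K 3 𝔭 h𝔭 he hf with hιdef
  -- rank one ⟹ `L(W, 1) = 0` (Kato's finiteness theorem, Cor. 14.3)
  have hL : W.entireLFunction 1 = 0 := by
    by_contra hL1
    obtain ⟨hfin, -, -⟩ := hKato W 3 hL1
    have h0 : W.mordellWeilRank = 0 := mordellWeilRank_eq_zero_of_finite W hfin
    omega
  -- the pinned datum with Kato's main conjecture; `ι[z]` is not `ℤ₃`-torsion
  obtain ⟨D, ⟨pin⟩, hMC⟩ := hRK W hj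
  have hz : ∀ m : ℕ, 3 ^ m • D.ι (Submodule.Quotient.mk D.z) ≠ 0 :=
    forall_pow_smul_iota_zeta_ne_zero' D hMC (h31 W D hj ⟨pin⟩ hrank hsha)
  -- Perrin-Riou's formula at `ι`, `P`, and the pinned datum (odd `d_K`)
  obtain ⟨c, -, hPRx⟩ := hPR W hj K N hN hK hodd hHN hH3 hLK ι P hP hL D pin hMC
  have ht : c * padicLogOmega W 3 ι P ^ 2 ≠ 0 := h31b W D pin hj hrank hsha hz _ hPRx
  -- but a torsion Heegner point has `log_ω(P) = 0`
  have hlog : padicLogOmega W 3 ι P = 0 := by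
    unfold padicLogOmega
    rw [AcPConverseLinks.padicLogPoint_formalIndex_smul_eq_zero_of_isOfFinAddOrder W 3 ι hPtor,
      zero_div]
  exact ht (by rw [hlog, zero_pow two_ne_zero, mul_zero])

/-! ## §3 The end-state census: crux B from twelve citation-borne facts + (LB-bdp) + (ERL₃) -/

/-- **END-STATE KERNEL CENSUS OF S2b's CRUX B: `AnalyticRankOneOfRankOneFiniteShaThree` ⟸ {six refereed theorems
(`3`-parity, modularity, Hoffstein–Luo, Kato finiteness, Heegner points, Gross–Zagier + Kolyvagin); three reading-grade Kato
facts (`nonempty_iwasawaH2Data`, `thm12_4`, `finite_descentCokernel_of_rankOne`); (T1) Hsieh 2014 Thm A at any level; the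
Tate–Sen theorem `TateSenCharacterVanishing 3`; Bertolini–Darmon–Prasanna 2013 Thm 5.5} [ALL citation-borne] + the ∀-frame
value formula at 𝟙 `ThreeAdicBDPValueAtOne` [(LB-bdp), WRITTEN] + the Kato ↔ BDP reciprocity `ThreeAdicKatoBDPReciprocity`
[(ERL₃), OPEN].** Proof: choose the Heegner field with `d_K ≡ 1 (mod 8)`
(`analyticRankOne_of_facts_of_heegnerNonTorsionOddDisc`, p489731); [ABS] §10.1.3 at odd `d_K` (§2) with (R+K) from
`readingRK_jZero_three_of_facts nonempty_iwasawaH1Data_holds h2 h12`, (3.1′) from the fact `h31` along the v2 pin, (3.1″) from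
`reading31b_three_of_fact locP_kernel_isTorsion_of_rankOne_holds`; Perrin-Riou at odd `d_K` (§1) from existence-odd
(`threeAdicBDPElementExistsOddDisc_of_anyLevel_of_tateSen_of_bdp2013 hT1 hTS hBDP`, p489731), `hV` and `hERL`. CONDITIONAL;
closes nothing; no (LB-wan), no descent statement, no construction stub occurs. [cite: AlpogeBhargavaShnidman2022, App. A Thm. 10.1 and Thm. 10.8 (pp. 33–34)]
[cite: Kato2004Asterisque, Thm. 12.4 (p. 221), (14.9.3) (p. 240), §14.14 (p. 243)] [cite: BertoliniDarmonPrasanna2013, Thm. 5.5 and (5.1.16) (p. 60)]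
[cite: Hsieh2014, Thm. A p. 712] [cite: BrinonConrad2009, Thm. 2.2.7] -/
theorem cruxB_of_namedFacts_of_anyLevel_of_tateSen_of_bdp2013_of_value_of_reciprocity
    (hpar : ∀ (W : WeierstrassCurve ℚ) [W.IsElliptic] (p : ℕ) [Fact p.Prime], p_parity W p)
    (hmod : ModularForms.exists_isNewformOf) (hHL : HoffsteinLuo1997_exists_twist_L_one_ne_zero)
    (hKato : ∀ (W : WeierstrassCurve ℚ) [W.IsElliptic] (p : ℕ) [Fact p.Prime],
      kato_finite_of_L_one_ne_zero W p)
    (hHP : ∀ (W : WeierstrassCurve ℚ) (K : Type) [Field K] [NumberField K],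
      exists_isHeegnerPoint W K)
    (hGZ : ∀ (W : WeierstrassCurve ℚ) (N : ℕ) [NeZero N] (K : Type) [Field K] [NumberField K],
      analyticRankEK_eq_one_iff_heegner_nonTorsion W N K)
    (h2 : nonempty_iwasawaH2Data) (h12 : thm12_4) (h31 : finite_descentCokernel_of_rankOne)
    (hT1 : Hsieh2014.thmA_exists_isHsiehLFunction_unrPeriod_anyLevel) (hTS : TateSenCharacterVanishing 3)
    (hBDP : bertoliniDarmonPrasanna2013_centralValue_reciprocity)
    (hV : ThreeAdicBDPValueAtOne) (hERL : ThreeAdicKatoBDPReciprocity) :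
    AnalyticRankOneOfRankOneFiniteShaThree :=
  analyticRankOne_of_facts_of_heegnerNonTorsionOddDisc hpar hmod hHL hKato hHP hGZ
    (heegnerNonTorsionOddDisc_of_prFormulaOddDisc_of_readings hKato
      (CongruentShaFreeCutKatoZetaRoadReadings.readingRK_jZero_three_of_facts nonempty_iwasawaH1Data_holds h2 h12)
      (fun _ _ _ _ D _ hD hrank hsha ↦ finite_coinvariants_H2_of_rankOne_of_nonempty_pinH2 h31 D hD hrank hsha)
      (CongruentShaFreeCutKatoReading31b.reading31b_three_of_fact locP_kernel_isTorsion_of_rankOne_holds)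
      (prFormulaAtThreeOddDisc_of_existsOddDisc_of_value_of_reciprocity
        (threeAdicBDPElementExistsOddDisc_of_anyLevel_of_tateSen_of_bdp2013 hT1 hTS hBDP) hV hERL))

end Summit.BirchSwinnertonDyer.BirchSwinnertonDyer.Theorems.MordellShaFreeCutRoadsMeetFromPrint

end
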